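import Literature.AlgebraicGeometry.ShimuraVarieties.UnitaryBallCanonicalAutomorphyFactor
import HarnessLib

/-!
# The automorphy factors `ρ(J(g, z))⁻¹` of the `K`-types of `U(2) × U(1)` and their Cauchy–Riemann dictionary

Topic `AlgebraicGeometry/ShimuraVarieties`; namespace `Literature.AlgebraicGeometry.ShimuraVarieties.BallForms`.
Sequel of `UnitaryBallCanonicalAutomorphyFactor` (the canonical automorphy factor
`J(g, z) = (Λ(g,z), μ(g,z)) ∈ K_ℂ = GL₂(ℂ) × GL₁(ℂ)` of `U(2,1)` on `𝔹²`) and of `UnitaryBallCauchyRiemannDictionary`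
(the dictionary `F holomorphic ⟺ 𝔭₋ · f = 0` for every `IsHolMatrixFactor` / `IsHolScalarFactor`). Definitions with
bodies and kernel-checked theorems; no named fact.

* §1 `IsHolKRep ρ`: a holomorphic matrix representation `ρ : M₂(ℂ) × ℂ → M_ι(ℂ)` of `K_ℂ = GL₂(ℂ) × GL₁(ℂ)`
  (`ρ(1,1) = 1`, multiplicative on `GL₂(ℂ) × ℂˣ`, entries `ℂ`-differentiable there).
* §2 **the automorphy factor of the `K`-type `ρ`**, `kTypeFactor ρ g z = ρ(Λ(g,z)⁻¹, μ(g,z)⁻¹) = ρ(J(g,z))⁻¹` — the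
  inverse makes it a PULL-BACK cocycle `M(gh,z) = M(h,z) M(g,hz)` in the convention of the tree's `matrixCocycle` —
  and the main theorem **`IsHolKRep.isHolMatrixFactor`: it is a holomorphic matrix factor** (cocycle identities of
  `(Λ, μ)`, holomorphy in `z`, first-order triviality along `exp 𝔭` at `x₀`, all by the chain rule through `ρ`).
  Hence, with NO hypothesis left, the Cauchy–Riemann dictionary of D9-1 for every such `ρ`:
  `F ∈ holomorphic ⟺ IsPHolomorphic f ⟺ IsKilledByPMinus f` for the group function
  `f(g) = ρ(J(g,x₀))⁻¹ F(g·x₀)` (`IsHolKRep.mem_holomorphic_iff_isPHolomorphic`, `…_isKilledByPMinus`, and the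
  `holWeightForms` versions).
* §3 **the weight is `ρ|_K`**: `kTypeFactor ρ (k⁻¹) x₀ = ρ(A, d)` for `k = diag(A, d) ∈ K = U(2) × U(1)`
  (`kTypeFactor_inv_blockU_x₀`), i.e. the tree's isotropy representation `weightOf x₀` of the cocycle is `ρ`
  transported along `stabilizerEquivK21` (`IsHolKRep.weightOf_kTypeFactor`): automorphic forms for `kTypeFactor ρ` are
  exactly the vector-valued forms of `K`-type `ρ`.
* §4 instances: the standard representation, the trivial one, twists by the characters `det(X)ᵃ sᵇ` (`a, b ∈ ℤ`),
  Kronecker products, the characters themselves, and `cotRep (X, s) = s (X⁻¹)ᵀ` whose restriction to `K` is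
  `𝔭₋ = τ` (`cotRep_matA_sclD_mulVec`, the `K`-type of holomorphic `1`-forms, `U21KTypes.pMinus`) and whose factor IS
  the tree's cotangent factor: `kTypeFactor cotRep g z = (Jac g z)ᵀ`, `matrixCocycle (kTypeFactor cotRep) =
  cotangentCocycle` — so D9-1's cotangent dictionary is the case `ρ = cotRep`. Every irreducible representation
  `Symᵐ ⊗ detᵃ ⊗ χᵇ` of `U(2) × U(1)` is a direct summand of `std^{⊗m} ⊗ detᵃ χᵇ`, an instance of §4; forms of that
  `K`-type are the `std^{⊗m} ⊗ detᵃχᵇ`-valued ones with values in the summand, to which §2 applies verbatim.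
* §5 scalar `K`-types: the character factors `det Λ(g,z)ᵃ μ(g,z)ᵇ` are `IsHolScalarFactor`s
  (`isHolScalarFactor_character`), with weight `det(A)^{−a} d^{−b}` and dictionary for `V`-valued `F`; the tree's
  canonical weight-`k` factor `(det Jac)ᵏ` is the character `(k, −2k)` (`canonicalFactor_pow_eq`).

Design. `ρ` is a bare function on `M₂(ℂ) × ℂ` (no Mathlib `Representation` of the non-compact `K_ℂ` is needed; only
its values on `GL₂(ℂ) × ℂˣ` matter), holomorphy is stated entrywise on the product of the coordinate spaces
`(Fin 2 → Fin 2 → ℂ) × ℂ` (sup norms; no norm on `Matrix` is chosen), and the recipe `M_ρ = ρ(J)⁻¹` (rather than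
`ρ(J)`) matches the tree's pull-back convention so that `weightOf x₀ = ρ` on the nose.

NOT HERE: a matrix model of `Symᵐ` as an `IsHolKRep` in its own right (covered as a summand of `std^{⊗m}`, see
above); `(𝔤, K)`-module bookkeeping (Borel–Wallach II 3.1(b), VII 3.4–3.6); smoothness of particular forms.

## References

* M. H. Lee, *Mixed Automorphic Forms, Torus Bundles, and Jacobi Forms*, LNM 1845 (2004), §6.2 (6.27) (canonical
  automorphy factor `J : G × D → K_ℂ`) and §6.3 (6.55) (the automorphy factor `det Ad_{𝔭₊}(J(g,z))` attached to a
  holomorphic representation of `K_ℂ`) [Lee2004].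
* A. Borel, *Automorphic forms on `SL₂(ℝ)`* (1997), 3.3 (7), 4.1 (5)–(6), 4.2 (3), Lemma 4.4, §5.13–5.14 (forms of
  `K`-type `m` ⟷ the factor `μ(g, z)^{−m}`: the rank-one case of §2–§3) [Borel1997].
* A. Borel, N. Wallach (2000), VI 4.7–4.8 (`K = U(2) × U(1)`, `τ₁ = 𝔭₊`, the `K`-types of ball quotients) [BorelWallach2000].
* S. Kudla, *From modular forms to automorphic representations* (2004), Lemma 1.3; D. Bump, *Automorphic Forms and
  Representations* (1997), §3.2 (2.13) (the `SL₂` prototypes of the dictionary) [Kudla2004] [Bump1997].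

## Provenance

Written for the COR-CM cell `pub-hodgecm2` (Hodge ladder stage 2), literature fan-out row D9 (b) «`𝔭₋·F = 0 ⟺`
holomorphy of the associated vector-valued function», gap G1 of the D9 audit (the `K`-type factors). Kernel only;
nothing here is a claim of the manuscripts adjudicated by that cell.
-/

set_option autoImplicit false

noncomputable section

open scoped Matrix Matrix.Norms.Operator Topology ComplexConjugate Kronecker
open MulAction
open Literature.Geometry.ComplexHyperbolic
open Literature.Geometry.ComplexHyperbolic.BallModel
open Literature.NumberTheory.Automorphic Literature.NumberTheory.Automorphic.AutomorphyFactor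
open Literature.NumberTheory.Automorphic.U21 (K21 matA sclD)

namespace Literature.AlgebraicGeometry.ShimuraVarieties

namespace BallForms

/-! ### 0. Calculus plumbing -/

section Plumbing

variable {E : Type*} [NormedAddCommGroup E] [NormedSpace ℂ E]

/-- The entries of the inverse of a `2 × 2` matrix-valued function with `ℂ`-differentiable entries are
`ℂ`-differentiable where the determinant is a unit (adjugate formula). [folklore] -/
private theorem differentiableAt_inv_apply {N : E → Matrix (Fin 2) (Fin 2) ℂ} {y : E}
    (hN : ∀ i j, DifferentiableAt ℂ (fun y => N y i j) y) (hdet : IsUnit (N y).det) (i j : Fin 2) :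
    DifferentiableAt ℂ (fun y => (N y)⁻¹ i j) y := by
  have hd : DifferentiableAt ℂ (fun y => (N y).det) y := by
    simp only [Matrix.det_fin_two]
    exact ((hN 0 0).mul (hN 1 1)).sub ((hN 0 1).mul (hN 1 0))
  have hadj : DifferentiableAt ℂ (fun y => (N y).adjugate i j) y := by
    fin_cases i <;> fin_cases j
    · simpa [Matrix.adjugate_fin_two] using hN 1 1
    · simpa [Matrix.adjugate_fin_two] using (hN 0 1).neg
    · simpa [Matrix.adjugate_fin_two] using (hN 1 0).neg
    · simpa [Matrix.adjugate_fin_two] using hN 0 0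
  have hfun : (fun y => (N y)⁻¹ i j) = fun y => ((N y).det)⁻¹ * (N y).adjugate i j := by
    funext y
    rw [Matrix.inv_def, Ring.inverse_eq_inv, Matrix.smul_apply, smul_eq_mul]
  rw [hfun]
  exact (hd.inv hdet.ne_zero).mul hadj

/-- A function on the ball which is the restriction of an ambient function `ℂ`-differentiable at the points of
the ball is holomorphic (plumbing for `holomorphic`). [folklore] -/
private theorem mem_holomorphic_of_ambient' {W : Type*} [NormedAddCommGroup W] [NormedSpace ℂ W] (φ : Ball → W)
    (Φ : (Fin 2 → ℂ) → W) (h : ∀ z : Ball, φ z = Φ z.1) (hΦ : ∀ y ∈ ballSet, DifferentiableAt ℂ Φ y) :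
    φ ∈ holomorphic W := by
  rw [mem_holomorphic_iff]
  intro y hy
  have heq : extend W φ =ᶠ[𝓝 y] Φ := by
    filter_upwards [isOpen_ballSet.mem_nhds hy] with w hw
    rw [← h ⟨w, hw⟩, ← extend_apply_coe φ ⟨w, hw⟩]
  exact ((heq.differentiableAt_iff).2 (hΦ y hy)).differentiableWithinAt

/-- The coordinate `p ↦ p.1 k l` on `(ℂ^{2×2}) × ℂ` is `ℂ`-differentiable. [folklore] -/
private theorem differentiableAt_fst_apply (k l : Fin 2) (p : (Fin 2 → Fin 2 → ℂ) × ℂ) :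
    DifferentiableAt ℂ (fun q : (Fin 2 → Fin 2 → ℂ) × ℂ => q.1 k l) p :=
  differentiableAt_pi.1 (differentiableAt_pi.1 differentiableAt_fst k) l

/-- `p ↦ det p.1` on `(ℂ^{2×2}) × ℂ` is `ℂ`-differentiable. [folklore] -/
private theorem differentiableAt_det_fst (p : (Fin 2 → Fin 2 → ℂ) × ℂ) :
    DifferentiableAt ℂ (fun q : (Fin 2 → Fin 2 → ℂ) × ℂ => (Matrix.of q.1).det) p := by
  simp only [Matrix.det_fin_two, Matrix.of_apply]
  exact ((differentiableAt_fst_apply 0 0 p).mul (differentiableAt_fst_apply 1 1 p)).sub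
    ((differentiableAt_fst_apply 0 1 p).mul (differentiableAt_fst_apply 1 0 p))

/-- The ambient matrix of the zero extensions of the entries of `z ↦ Λ(g, z)`. [folklore] -/
private def lamExt (g : U21) (y : Fin 2 → ℂ) : Matrix (Fin 2) (Fin 2) ℂ :=
  Matrix.of fun i j => extend ℂ (fun z : Ball => lam g z i j) y

/-- On the ball `lamExt g z = Λ(g, z)`. [folklore] -/
private theorem lamExt_coe (g : U21) (z : Ball) : lamExt g z.1 = lam g z := by
  ext i j
  rw [lamExt, Matrix.of_apply, extend_apply_coe]

/-- The entries of `lamExt g` are `ℂ`-differentiable at the points of the ball. [folklore] -/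
private theorem differentiableAt_lamExt_apply (g : U21) (i j : Fin 2) {y : Fin 2 → ℂ} (hy : y ∈ ballSet) :
    DifferentiableAt ℂ (fun y => lamExt g y i j) y :=
  differentiableAt_extend (lam_apply_mem_holomorphic g i j) ⟨y, hy⟩

/-- The zero extension of `z ↦ μ(g, z)` is `ℂ`-differentiable at the points of the ball. [folklore] -/
private theorem differentiableAt_muExt (g : U21) {y : Fin 2 → ℂ} (hy : y ∈ ballSet) :
    DifferentiableAt ℂ (extend ℂ fun z : Ball => mu g z) y :=
  differentiableAt_extend (mu_mem_holomorphic g) ⟨y, hy⟩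

end Plumbing

/-! ### 1. Holomorphic representations of `K_ℂ = GL₂(ℂ) × GL₁(ℂ)` -/

section KRep

variable {ι : Type}

/-- The **automorphy factor of the `K`-type `ρ`**: `M_ρ(g, z) = ρ(Λ(g,z)⁻¹, μ(g,z)⁻¹) = ρ(J(g,z))⁻¹`, a PULL-BACK
cocycle (`M(gh, z) = M(h, z) M(g, h z)`, the convention of the tree's `matrixCocycle` / `IsHolMatrixFactor`) whose
isotropy representation at `x₀` is `ρ|_K` (`kTypeFactor_inv_blockU_x₀`); Lee's `j_H = det Ad_{𝔭₊}(J)` and Borel's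
`μ(g,z)^{−m}` are the cases `ρ = det ∘ Ad_{𝔭₊}`, `ρ = χ^{m}`. [cite: Lee2004, (6.27) and (6.55)] -/
def kTypeFactor (ρ : Matrix (Fin 2) (Fin 2) ℂ → ℂ → Matrix ι ι ℂ) (g : U21) (z : Ball) : Matrix ι ι ℂ :=
  ρ (lam g z)⁻¹ (mu g z)⁻¹

/-- `M_ρ(g, z) = ρ(Λ(g,z)⁻¹, μ(g,z)⁻¹)`. [cite: Lee2004, (6.55)] -/
theorem kTypeFactor_apply (ρ : Matrix (Fin 2) (Fin 2) ℂ → ℂ → Matrix ι ι ℂ) (g : U21) (z : Ball) :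
    kTypeFactor ρ g z = ρ (lam g z)⁻¹ (mu g z)⁻¹ := rfl

/-- **`M_ρ(k⁻¹, x₀) = ρ(A, d)` for `k = diag(A, d) ∈ K`**: the isotropy representation
`k ↦ M(k⁻¹, x₀)` (`IsPullbackCocycle.weightOf`) of the factor `M_ρ` is `ρ` restricted to `K = U(2) × U(1)`.
[cite: Borel1997, 4.2 (3) and §5.13] -/
theorem kTypeFactor_inv_blockU_x₀ (ρ : Matrix (Fin 2) (Fin 2) ℂ → ℂ → Matrix ι ι ℂ) (k : K21) :
    kTypeFactor ρ (blockU k)⁻¹ x₀ = ρ (matA k) (sclD k) := by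
  have hA : (matA k⁻¹)⁻¹ = matA k :=
    Matrix.inv_eq_right_inv (by rw [← U21.matA_mul, inv_mul_cancel, U21.matA_one])
  have hd : (sclD k⁻¹)⁻¹ = sclD k :=
    inv_eq_of_mul_eq_one_right (by rw [← U21.sclD_mul, inv_mul_cancel, U21.sclD_one])
  rw [kTypeFactor_apply, ← map_inv, lam_blockU_x₀, mu_blockU_x₀, hA, hd]

variable [Fintype ι] [DecidableEq ι]

/-- A **holomorphic matrix representation of `K_ℂ = GL₂(ℂ) × GL₁(ℂ)`** (the complexification of
`K = U(2) × U(1)`) on `ℂ^ι`, given as a function on all of `M₂(ℂ) × ℂ` whose values off `GL₂(ℂ) × ℂˣ` are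
irrelevant: `ρ(1, 1) = 1`, `ρ(XY, st) = ρ(X, s) ρ(Y, t)` on invertible arguments, and the entries of `ρ` are
`ℂ`-differentiable at every point of `GL₂(ℂ) × ℂˣ` as functions of the `4 + 1` complex coordinates. Instances (§4):
the standard representation, the characters `det(X)ᵃ sᵇ` (`a, b ∈ ℤ`), character twists and Kronecker products —
every irreducible representation `Symᵐ ⊗ detᵃ ⊗ χᵇ` of `U(2) × U(1)` is a direct summand of the restriction to `K`
of one of these (§4). [cite: Lee2004, (6.27) and (6.55)] -/
structure IsHolKRep (ρ : Matrix (Fin 2) (Fin 2) ℂ → ℂ → Matrix ι ι ℂ) : Prop where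
  /-- `ρ(1, 1) = 1`. -/
  map_one : ρ 1 1 = 1
  /-- `ρ(XY, st) = ρ(X, s) ρ(Y, t)` on `GL₂(ℂ) × ℂˣ`. -/
  map_mul : ∀ (X Y : Matrix (Fin 2) (Fin 2) ℂ) (s t : ℂ), IsUnit X.det → IsUnit Y.det → s ≠ 0 → t ≠ 0 →
    ρ (X * Y) (s * t) = ρ X s * ρ Y t
  /-- The entries of `ρ` are `ℂ`-differentiable at the points of `GL₂(ℂ) × ℂˣ`. -/
  differentiableAt : ∀ (X : Matrix (Fin 2) (Fin 2) ℂ) (s : ℂ), IsUnit X.det → s ≠ 0 → ∀ k l : ι,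
    DifferentiableAt ℂ (fun p : (Fin 2 → Fin 2 → ℂ) × ℂ => ρ (Matrix.of p.1) p.2 k l) (Matrix.of.symm X, s)

namespace IsHolKRep

variable {ρ : Matrix (Fin 2) (Fin 2) ℂ → ℂ → Matrix ι ι ℂ}

/-- Chain rule: along a family `(Φ(y), φ(y))` with `ℂ`-differentiable entries and invertible value, the entries of
`y ↦ ρ(Φ(y), φ(y))` are `ℂ`-differentiable. [folklore] -/
private theorem differentiableAt_comp (hρ : IsHolKRep ρ) {E : Type*} [NormedAddCommGroup E] [NormedSpace ℂ E]
    {Φ : E → Matrix (Fin 2) (Fin 2) ℂ} {φ : E → ℂ} {y : E}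
    (hΦ : ∀ i j, DifferentiableAt ℂ (fun y => Φ y i j) y) (hφ : DifferentiableAt ℂ φ y)
    (hdet : IsUnit (Φ y).det) (hs : φ y ≠ 0) (k l : ι) :
    DifferentiableAt ℂ (fun y => ρ (Φ y) (φ y) k l) y := by
  have hP : DifferentiableAt ℂ (fun y => (Matrix.of.symm (Φ y), φ y)) y :=
    (differentiableAt_pi.2 fun i => differentiableAt_pi.2 fun j => hΦ i j).prodMk hφ
  exact (hρ.differentiableAt (Φ y) (φ y) hdet hs k l).comp y hP

/-- … the same for the inverted family `y ↦ ρ(Φ(y)⁻¹, φ(y)⁻¹)`. [folklore] -/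
private theorem differentiableAt_comp_inv (hρ : IsHolKRep ρ) {E : Type*} [NormedAddCommGroup E] [NormedSpace ℂ E]
    {Φ : E → Matrix (Fin 2) (Fin 2) ℂ} {φ : E → ℂ} {y : E}
    (hΦ : ∀ i j, DifferentiableAt ℂ (fun y => Φ y i j) y) (hφ : DifferentiableAt ℂ φ y)
    (hdet : IsUnit (Φ y).det) (hs : φ y ≠ 0) (k l : ι) :
    DifferentiableAt ℂ (fun y => ρ (Φ y)⁻¹ (φ y)⁻¹ k l) y :=
  hρ.differentiableAt_comp (Φ := fun y => (Φ y)⁻¹) (φ := fun y => (φ y)⁻¹)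
    (differentiableAt_inv_apply hΦ hdet) (hφ.inv hs) (Matrix.isUnit_nonsing_inv_det _ hdet) (inv_ne_zero hs) k l

end IsHolKRep

/-! ### 2. The automorphy factor of a `K`-type and the dictionary -/

namespace IsHolKRep

variable {ρ : Matrix (Fin 2) (Fin 2) ℂ → ℂ → Matrix ι ι ℂ}

/-- `M_ρ(g, z) = ρ(J(g, z))⁻¹`. [cite: Lee2004, (6.55)] -/
theorem kTypeFactor_eq_inv (hρ : IsHolKRep ρ) (g : U21) (z : Ball) :
    kTypeFactor ρ g z = (ρ (lam g z) (mu g z))⁻¹ := by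
  refine (Matrix.inv_eq_left_inv ?_).symm
  rw [kTypeFactor_apply, ← hρ.map_mul _ _ _ _ (Matrix.isUnit_nonsing_inv_det _ (isUnit_det_lam g z))
    (isUnit_det_lam g z) (inv_ne_zero (mu_ne_zero g z)) (mu_ne_zero g z),
    Matrix.nonsing_inv_mul _ (isUnit_det_lam g z), inv_mul_cancel₀ (mu_ne_zero g z), hρ.map_one]

/-- **The automorphy factor of a holomorphic representation of `K_ℂ` is a holomorphic matrix factor**: cocycle
identities from those of `(Λ, μ)`, holomorphy in `z` and first-order triviality along `exp 𝔭` by the chain rule.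
[cite: Lee2004, (6.55)] -/
theorem isHolMatrixFactor (hρ : IsHolKRep ρ) : IsHolMatrixFactor (kTypeFactor ρ) where
  map_one z := by
    rw [kTypeFactor_apply, lam_one, mu_one, inv_one, inv_one, hρ.map_one]
  map_mul g h z := by
    rw [kTypeFactor_apply, kTypeFactor_apply, kTypeFactor_apply, lam_mul, mu_mul, Matrix.mul_inv_rev,
      mul_inv_rev]
    exact hρ.map_mul _ _ _ _ (Matrix.isUnit_nonsing_inv_det _ (isUnit_det_lam h z))
      (Matrix.isUnit_nonsing_inv_det _ (isUnit_det_lam g (h • z))) (inv_ne_zero (mu_ne_zero h z))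
      (inv_ne_zero (mu_ne_zero g (h • z)))
  mem_holomorphic g k l := by
    refine mem_holomorphic_of_ambient' _
      (fun y => ρ (lamExt g y)⁻¹ (extend ℂ (fun z : Ball => mu g z) y)⁻¹ k l) (fun z => ?_) fun y hy => ?_
    · rw [kTypeFactor_apply, lamExt_coe, extend_apply_coe]
    · have hdet : IsUnit (lamExt g y).det := by
        rw [show y = (⟨y, hy⟩ : Ball).1 from rfl, lamExt_coe]; exact isUnit_det_lam g _
      have hs : extend ℂ (fun z : Ball => mu g z) y ≠ 0 := by
        rw [show y = (⟨y, hy⟩ : Ball).1 from rfl, extend_apply_coe]; exact mu_ne_zero g _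
      exact hρ.differentiableAt_comp_inv (fun i j => differentiableAt_lamExt_apply g i j hy)
        (differentiableAt_muExt g hy) hdet hs k l
  differentiableAt_expP k l := by
    have hdet : IsUnit (lam (expP 0) x₀).det := by
      rw [expP_zero, lam_one, Matrix.det_one]; exact isUnit_one
    have hs : mu (expP 0) x₀ ≠ 0 := mu_ne_zero _ _
    exact hρ.differentiableAt_comp_inv (Φ := fun b : Fin 2 → ℂ => lam (expP b) x₀)
      (φ := fun b : Fin 2 → ℂ => mu (expP b) x₀) (fun i j => differentiableAt_lam_expP_apply i j)
      differentiableAt_mu_expP hdet hs k l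

/-- **Cauchy–Riemann dictionary for the `K`-type `ρ` (both directions)**: `F : 𝔹² → ℂ^ι` is holomorphic iff its
group function `g ↦ ρ(J(g, x₀))⁻¹ F(g·x₀)` is `𝔭`-holomorphic. [cite: Kudla2004, Lemma 1.3] -/
theorem mem_holomorphic_iff_isPHolomorphic (hρ : IsHolKRep ρ) (F : Ball → (ι → ℂ)) :
    F ∈ holomorphic (ι → ℂ) ↔ IsPHolomorphic (toGroupFun (matrixCocycle (kTypeFactor ρ)) x₀ F) :=
  hρ.isHolMatrixFactor.mem_holomorphic_iff_isPHolomorphic F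

/-- **Cauchy–Riemann dictionary for the `K`-type `ρ`, `𝔭₋` form**: `F` is holomorphic iff its group function is
killed by `𝔭₋`. [cite: Bump1997, §3.2 (2.13)] -/
theorem mem_holomorphic_iff_isKilledByPMinus (hρ : IsHolKRep ρ) (F : Ball → (ι → ℂ)) :
    F ∈ holomorphic (ι → ℂ) ↔ IsKilledByPMinus (toGroupFun (matrixCocycle (kTypeFactor ρ)) x₀ F) :=
  hρ.isHolMatrixFactor.mem_holomorphic_iff_isKilledByPMinus F

/-- **Holomorphic weight forms of `K`-type `ρ` are exactly the `𝔭`-holomorphic ones.** [cite: Borel1997, §5.13–5.14] -/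
theorem mem_holWeightForms_iff_isPHolomorphic (hρ : IsHolKRep ρ) {Δ : Subgroup U21}
    (f : Literature.NumberTheory.Automorphic.weightForms Δ (stabilizer U21 x₀).subtype
      (hρ.isHolMatrixFactor.isPullbackCocycle.weightOf x₀)) :
    f ∈ holWeightForms Δ hρ.isHolMatrixFactor.isPullbackCocycle ↔ IsPHolomorphic (f : U21 → (ι → ℂ)) :=
  hρ.isHolMatrixFactor.mem_holWeightForms_iff f

/-- … `𝔭₋` form: `f ∈ holWeightForms Δ ⟺ 𝔭₋ · f = 0`. [cite: Borel1997, §5.13–5.14] -/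
theorem mem_holWeightForms_iff_isKilledByPMinus (hρ : IsHolKRep ρ) {Δ : Subgroup U21}
    (f : Literature.NumberTheory.Automorphic.weightForms Δ (stabilizer U21 x₀).subtype
      (hρ.isHolMatrixFactor.isPullbackCocycle.weightOf x₀)) :
    f ∈ holWeightForms Δ hρ.isHolMatrixFactor.isPullbackCocycle ↔ IsKilledByPMinus (f : U21 → (ι → ℂ)) := by
  rw [isKilledByPMinus_iff_isPHolomorphic, hρ.mem_holWeightForms_iff_isPHolomorphic]

end IsHolKRep

/-! ### 3. The weight: the isotropy representation of `M_ρ` at `x₀` is `ρ|_K` -/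

/-- The weight of `M_ρ` in the tree's sense: `weightOf x₀ (diag(A,d)) v = ρ(A, d) v`. [cite: Borel1997, §5.13] -/
theorem IsHolKRep.weightOf_kTypeFactor {ρ : Matrix (Fin 2) (Fin 2) ℂ → ℂ → Matrix ι ι ℂ} (hρ : IsHolKRep ρ)
    (k : K21) (v : ι → ℂ) :
    hρ.isHolMatrixFactor.isPullbackCocycle.weightOf x₀ (blockK k) v = ρ (matA k) (sclD k) *ᵥ v := by
  rw [IsPullbackCocycle.weightOf_apply, coe_blockK, matrixCocycle_apply, kTypeFactor_inv_blockU_x₀]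

/-! ### 4. Instances: standard representation, characters, twists, Kronecker products, the cotangent type -/

/-- The standard representation `(X, s) ↦ X` of `K_ℂ` is holomorphic. [cite: Lee2004, (6.55)] -/
theorem isHolKRep_std : IsHolKRep (ι := Fin 2) (fun X _ => X) where
  map_one := rfl
  map_mul _ _ _ _ _ _ _ _ := rfl
  differentiableAt _ _ _ _ k l := differentiableAt_fst_apply k l _

/-- The trivial representation of `K_ℂ` on `ℂ^ι` is holomorphic. [cite: Lee2004, (6.55)] -/
theorem isHolKRep_trivial : IsHolKRep (fun (_ : Matrix (Fin 2) (Fin 2) ℂ) (_ : ℂ) => (1 : Matrix ι ι ℂ)) where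
  map_one := rfl
  map_mul _ _ _ _ _ _ _ _ := (Matrix.mul_one _).symm
  differentiableAt _ _ _ _ _ _ := differentiableAt_const _

namespace IsHolKRep

variable {ρ : Matrix (Fin 2) (Fin 2) ℂ → ℂ → Matrix ι ι ℂ}

/-- **Twist by the character `det(X)ᵃ sᵇ`** (`a, b ∈ ℤ`) of a holomorphic representation is holomorphic.
[cite: Lee2004, (6.55)] -/
theorem twist (hρ : IsHolKRep ρ) (a b : ℤ) : IsHolKRep (fun X s => (X.det ^ a * s ^ b) • ρ X s) where
  map_one := by rw [Matrix.det_one, one_zpow, one_zpow, one_mul, one_smul, hρ.map_one]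
  map_mul X Y s t hX hY hs ht := by
    rw [Matrix.det_mul, hρ.map_mul X Y s t hX hY hs ht, Matrix.smul_mul, Matrix.mul_smul, smul_smul, mul_zpow,
      mul_zpow]
    congr 1
    ring
  differentiableAt X s hX hs k l := by
    have hfun : (fun p : (Fin 2 → Fin 2 → ℂ) × ℂ => (((Matrix.of p.1).det ^ a * p.2 ^ b) • ρ (Matrix.of p.1) p.2) k l)
        = fun p => ((Matrix.of p.1).det ^ a * p.2 ^ b) * ρ (Matrix.of p.1) p.2 k l := by
      funext p; rw [Matrix.smul_apply, smul_eq_mul]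
    rw [hfun]
    have hX' : (Matrix.of (Matrix.of.symm X, s).1).det ≠ 0 := hX.ne_zero
    have hs' : (Matrix.of.symm X, s).2 ≠ 0 := hs
    exact (((differentiableAt_det_fst _).zpow (Or.inl hX')).mul
      (differentiableAt_snd.zpow (Or.inl hs'))).mul (hρ.differentiableAt X s hX hs k l)

/-- **Kronecker (tensor) products** of holomorphic representations are holomorphic. [cite: Lee2004, (6.55)] -/
theorem kronecker {ι' : Type} [Fintype ι'] [DecidableEq ι'] {ρ' : Matrix (Fin 2) (Fin 2) ℂ → ℂ → Matrix ι' ι' ℂ}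
    (hρ : IsHolKRep ρ) (hρ' : IsHolKRep ρ') : IsHolKRep (fun X s => ρ X s ⊗ₖ ρ' X s) where
  map_one := by rw [hρ.map_one, hρ'.map_one, Matrix.one_kronecker_one]
  map_mul X Y s t hX hY hs ht := by
    rw [hρ.map_mul X Y s t hX hY hs ht, hρ'.map_mul X Y s t hX hY hs ht, Matrix.mul_kronecker_mul]
  differentiableAt X s hX hs k l := by
    obtain ⟨k₁, k₂⟩ := k
    obtain ⟨l₁, l₂⟩ := l
    simp only [Matrix.kronecker_apply]
    exact (hρ.differentiableAt X s hX hs k₁ l₁).mul (hρ'.differentiableAt X s hX hs k₂ l₂)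

end IsHolKRep

/-- The characters `(X, s) ↦ det(X)ᵃ sᵇ · 1` of `K_ℂ` (on any `ℂ^ι`) are holomorphic. [cite: Lee2004, (6.55)] -/
theorem isHolKRep_character (a b : ℤ) :
    IsHolKRep (fun (X : Matrix (Fin 2) (Fin 2) ℂ) (s : ℂ) => (X.det ^ a * s ^ b) • (1 : Matrix ι ι ℂ)) :=
  isHolKRep_trivial.twist a b

/-- The representation `(X, s) ↦ s · (X⁻¹)ᵀ` of `K_ℂ` on `ℂ²`: on `K` it is `(A, d) ↦ d · Ā = 𝔭₋ = τ`, the `K`-type of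
holomorphic `1`-forms (`U21KTypes.pMinus`). [cite: BorelWallach2000, VI 4.8] -/
def cotRep (X : Matrix (Fin 2) (Fin 2) ℂ) (s : ℂ) : Matrix (Fin 2) (Fin 2) ℂ := s • (X⁻¹)ᵀ

/-- `cotRep X s = s · (X⁻¹)ᵀ`. [cite: BorelWallach2000, VI 4.8] -/
theorem cotRep_apply (X : Matrix (Fin 2) (Fin 2) ℂ) (s : ℂ) : cotRep X s = s • (X⁻¹)ᵀ := rfl

/-- `cotRep` is a holomorphic representation of `K_ℂ`. [cite: BorelWallach2000, VI 4.8] -/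
theorem isHolKRep_cotRep : IsHolKRep cotRep where
  map_one := by rw [cotRep_apply, inv_one, Matrix.transpose_one, one_smul]
  map_mul X Y s t _ _ _ _ := by
    rw [cotRep_apply, cotRep_apply, cotRep_apply, Matrix.mul_inv_rev, Matrix.transpose_mul, Matrix.smul_mul,
      Matrix.mul_smul, smul_smul]
  differentiableAt X s hX _ k l := by
    have hfun : (fun p : (Fin 2 → Fin 2 → ℂ) × ℂ => cotRep (Matrix.of p.1) p.2 k l) =
        fun p => p.2 * (Matrix.of p.1)⁻¹ l k := by
      funext p; rw [cotRep_apply, Matrix.smul_apply, Matrix.transpose_apply, smul_eq_mul]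
    rw [hfun]
    have hN : ∀ i j : Fin 2, DifferentiableAt ℂ (fun q : (Fin 2 → Fin 2 → ℂ) × ℂ => (Matrix.of q.1) i j)
        (Matrix.of.symm X, s) := fun i j => differentiableAt_fst_apply i j _
    have hdet : IsUnit (Matrix.of (Matrix.of.symm X, s).1).det := hX
    exact differentiableAt_snd.mul (differentiableAt_inv_apply hN hdet l k)

/-- On `K`, `cotRep` is `𝔭₋`: `cotRep A d · c = pMinus (A, d) c = d · Ā c`. [cite: BorelWallach2000, VI 4.8] -/
theorem cotRep_matA_sclD_mulVec (k : K21) (c : Fin 2 → ℂ) :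
    cotRep (matA k) (sclD k) *ᵥ c = U21.pMinus k c := by
  have hinv : (matA k)⁻¹ = (matA k)ᴴ := Matrix.inv_eq_left_inv (U21.conjTranspose_matA_mul_self k)
  rw [cotRep_apply, hinv, Matrix.smul_mulVec, U21.pMinus_apply]

/-- **The `K`-type factor of `cotRep` is the tree's cotangent factor `(Jac g z)ᵀ`** (`cotangentCocycle`): the
dictionary of `UnitaryBallCauchyRiemannDictionary` for `1`-forms is the case `ρ = cotRep` of the present one.
[cite: Borel1997, §5.14] -/
theorem kTypeFactor_cotRep (g : U21) (z : Ball) : kTypeFactor cotRep g z = (Jac g z)ᵀ := by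
  rw [kTypeFactor_apply, cotRep_apply, Matrix.nonsing_inv_nonsing_inv _ (isUnit_det_lam g z), transpose_Jac_eq]

/-- `kTypeFactor cotRep = ((g, z) ↦ (Jac g z)ᵀ)`. [cite: Borel1997, §5.14] -/
theorem kTypeFactor_cotRep_eq : kTypeFactor cotRep = fun (g : U21) (z : Ball) => (Jac g z)ᵀ :=
  funext fun g => funext fun z => kTypeFactor_cotRep g z

/-- `matrixCocycle (kTypeFactor cotRep) = cotangentCocycle`. [cite: Borel1997, §5.14] -/
theorem matrixCocycle_kTypeFactor_cotRep : matrixCocycle (kTypeFactor cotRep) = cotangentCocycle := by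
  rw [kTypeFactor_cotRep_eq]; rfl

end KRep

/-! ### 5. Scalar `K`-types: the characters `det Λ(g,z)ᵃ μ(g,z)ᵇ` -/

section Characters

variable {V : Type*} [NormedAddCommGroup V] [NormedSpace ℂ V]

/-- **The character factors `j_{a,b}(g, z) = det Λ(g,z)ᵃ μ(g,z)ᵇ` (`a, b ∈ ℤ`) are holomorphic scalar factors**; the
tree's canonical weight-`k` factor `(det Jac)ᵏ` is `j_{k,−2k}` (`canonicalFactor_pow_eq`). [cite: Lee2004, (6.55)] -/
theorem isHolScalarFactor_character (a b : ℤ) :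
    IsHolScalarFactor (fun (g : U21) (z : Ball) => (lam g z).det ^ a * mu g z ^ b) where
  map_one z := by rw [lam_one, mu_one, Matrix.det_one, one_zpow, one_zpow, one_mul]
  map_mul g h z := by
    rw [lam_mul, mu_mul, Matrix.det_mul, mul_zpow, mul_zpow]; ring
  mem_holomorphic g := by
    refine mem_holomorphic_of_ambient' _
      (fun y => (lamExt g y).det ^ a * (extend ℂ (fun z : Ball => mu g z) y) ^ b) (fun z => ?_) fun y hy => ?_
    · rw [lamExt_coe, extend_apply_coe]
    · have hdet : (lamExt g y).det ≠ 0 := by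
        rw [show y = (⟨y, hy⟩ : Ball).1 from rfl, lamExt_coe]; exact det_lam_ne_zero g _
      have hs : extend ℂ (fun z : Ball => mu g z) y ≠ 0 := by
        rw [show y = (⟨y, hy⟩ : Ball).1 from rfl, extend_apply_coe]; exact mu_ne_zero g _
      have hd : DifferentiableAt ℂ (fun y => (lamExt g y).det) y := by
        simp only [Matrix.det_fin_two]
        exact ((differentiableAt_lamExt_apply g 0 0 hy).mul (differentiableAt_lamExt_apply g 1 1 hy)).sub
          ((differentiableAt_lamExt_apply g 0 1 hy).mul (differentiableAt_lamExt_apply g 1 0 hy))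
      exact (hd.zpow (Or.inl hdet)).mul ((differentiableAt_muExt g hy).zpow (Or.inl hs))
  differentiableAt_expP := by
    have hdet : (lam (expP 0) x₀).det ≠ 0 := by
      rw [expP_zero, lam_one, Matrix.det_one]; exact one_ne_zero
    have hs : mu (expP 0) x₀ ≠ 0 := mu_ne_zero _ _
    have hd : DifferentiableAt ℂ (fun b : Fin 2 → ℂ => (lam (expP b) x₀).det) 0 := by
      simp only [Matrix.det_fin_two]
      exact ((differentiableAt_lam_expP_apply 0 0).mul (differentiableAt_lam_expP_apply 1 1)).sub
        ((differentiableAt_lam_expP_apply 0 1).mul (differentiableAt_lam_expP_apply 1 0))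
    exact (hd.zpow (Or.inl hdet)).mul (differentiableAt_mu_expP.zpow (Or.inl hs))

/-- The tree's canonical weight-`k` factor is the character `(k, −2k)`: `(det Jac g z)ᵏ = det Λ(g,z)ᵏ μ(g,z)^{−2k}`
(rank one: `dg/dw = μ_D(g,w)⁻²`). [cite: Borel1997, 4.1 (5)–(6)] -/
theorem canonicalFactor_pow_eq (g : U21) (z : Ball) (k : ℕ) :
    canonicalFactor g z ^ k = (lam g z).det ^ (k : ℤ) * mu g z ^ (-(2 * (k : ℤ))) := by
  rw [canonicalFactor_eq_det_lam_div, div_pow, zpow_neg, zpow_mul, zpow_natCast, zpow_natCast, zpow_ofNat,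
    div_eq_mul_inv]

/-- The weight of the character factor: `j_{a,b}(k⁻¹, x₀) = det(A)^{−a} d^{−b}` for `k = diag(A, d) ∈ K`.
[cite: Borel1997, 4.2 (3)] -/
theorem character_inv_blockU_x₀ (a b : ℤ) (k : K21) :
    (lam (blockU k)⁻¹ x₀).det ^ a * mu (blockU k)⁻¹ x₀ ^ b = (matA k).det ^ (-a) * sclD k ^ (-b) := by
  have hA : (matA k⁻¹).det = ((matA k).det)⁻¹ := by
    refine eq_inv_of_mul_eq_one_left ?_
    rw [← Matrix.det_mul, ← U21.matA_mul, inv_mul_cancel, U21.matA_one, Matrix.det_one]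
  have hd : sclD k⁻¹ = (sclD k)⁻¹ :=
    eq_inv_of_mul_eq_one_left (by rw [← U21.sclD_mul, inv_mul_cancel, U21.sclD_one])
  rw [← map_inv, lam_blockU_x₀, mu_blockU_x₀, hA, hd, inv_zpow', inv_zpow']

/-- **Cauchy–Riemann dictionary for the scalar `K`-type `(a, b)`**: `F : 𝔹² → V` is holomorphic iff
`g ↦ det Λ(g,x₀)ᵃ μ(g,x₀)ᵇ • F(g·x₀)` is `𝔭`-holomorphic. [cite: Kudla2004, Lemma 1.3] -/
theorem mem_holomorphic_iff_isPHolomorphic_character (a b : ℤ) (F : Ball → V) :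
    F ∈ holomorphic V ↔
      IsPHolomorphic (toGroupFun (scalarCocycle V fun g z => (lam g z).det ^ a * mu g z ^ b) x₀ F) :=
  (isHolScalarFactor_character a b).mem_holomorphic_iff_isPHolomorphic F

/-- … `𝔭₋` form. [cite: Bump1997, §3.2 (2.13)] -/
theorem mem_holomorphic_iff_isKilledByPMinus_character (a b : ℤ) (F : Ball → V) :
    F ∈ holomorphic V ↔
      IsKilledByPMinus (toGroupFun (scalarCocycle V fun g z => (lam g z).det ^ a * mu g z ^ b) x₀ F) :=
  (isHolScalarFactor_character a b).mem_holomorphic_iff_isKilledByPMinus F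

end Characters

end BallForms

end Literature.AlgebraicGeometry.ShimuraVarieties

end
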